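import Summits.AtomisticToContinuum.Crystallization.Theses.ExcessDecayLiouville
import Summits.AtomisticToContinuum.Crystallization.Theses.HcpDefectCounting
import Summits.AtomisticToContinuum.Crystallization.Theorems.ExcessDecayLiouvilleCoarseGrains
import Summits.AtomisticToContinuum.Crystallization.Theorems.CoarseGrains.Negative.PredicateAPI
import Summits.AtomisticToContinuum.Crystallization.Theorems.FineGrains.Negative.LoadBearing
import Summits.AtomisticToContinuum.Crystallization.Theorems.ExcessDecayLiouvilleFineGrainsIsoDictionaryAt
import Summits.AtomisticToContinuum.Crystallization.Theorems.ExcessDecayLiouvilleFineGrainsFlatComparison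
import Summits.AtomisticToContinuum.Crystallization.Theorems.ExcessDecayLiouvilleFineGrainsLineOneGlue
import Summits.AtomisticToContinuum.Crystallization.Theorems.ExcessDecayLiouvilleFineGrainsLineTwoGlue
import Summits.AtomisticToContinuum.Crystallization.Theorems.ExcessDecayLiouvilleFineGrainsSelfCertify
import Summits.AtomisticToContinuum.Crystallization.Theorems.ExcessDecayLiouvilleFineGrainsPigeonholeBall
import Summits.AtomisticToContinuum.Crystallization.Theorems.ExcessDecayLiouvilleFineGrainsLocalFlatness
import Summits.AtomisticToContinuum.Crystallization.Theorems.ExcessDecayLiouvilleGrainsGlueNearLimit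
import Literature.MathematicalPhysics.StatisticalMechanics.LennardJonesClusters
import Literature.MathematicalPhysics.StatisticalMechanics.BarlowStacking

/-!
# Crux `FineGrains` (stmt-AtomisticToContinuum-9330), line `Sketch`: the assembled CONDITIONAL reductions

Three sorry-free compositions, each concluding the route decl
`Summit.AtomisticToContinuum.Crystallization.Theses.ExcessDecayLiouville.FineGrains` BY NAME from named
items of the tree plus (for the two research lines) ONE explicit unproved hypothesis — CONDITIONAL results,
the crux item stays open:

* `FineGrains_of_defectCounting : HcpDefectCounting.HcpBulkFloor → HcpDefectCounting.HcpDefectCoercivity →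
  FineGrains` — the sibling reduction (TRIAGE-r1-1 §D of the crux, card sibling-reduction-at-epsilon): the
  landed `CoarseGrains_of` (crux stmt-9331, line vanishing-excess-truss-rigidity) re-run verbatim at
  `(ρ, ε)` — `trussPropagation` is `∀ ε`, and the chart dictionary at tolerance `ε` is the landed stub
  `stub_isoDictionaryAt`.  So `FineGrains` hangs on the same two items (stmt-14477, stmt-14476) as
  `CoarseGrains`.
* `tubeRigidity_of_tubeEnergyGap` and `FineGrains_of_coarseGrains_of_tubeEnergyGap : CoarseGrains →
  TubeEnergyGap → FineGrains` (LineOne of the picked line, card tube-energy-gap-pigeonhole): `CoarseGrains`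
  (crux stmt-9331) BY NAME, the landed stubs `stub_flatComparison` (hereditary slack of ground-state balls),
  `stub_lineOneGlue`, `stub_pigeonholeBall`, `stub_localFlatness`, and the ONE open hypothesis
  `TubeEnergyGap` (registered stub `stub_tubeEnergyGap` of the line, crux-strength, spelled out in the
  binder: a cluster confined to the `1/40`-tube of an admissible `Inner` datum admits a relaxed reference
  and a competitor gaining `κ` times the local quadratic form of the relaxed displacement, up to `C R²` —
  the finite-amplitude tube energy gap; with almost-minimality it gives mean-square flatness, pigeonhole a
  flat ball, and local flatness an `ε`-fine `ρ`-ball: `tubeRigidity_of_tubeEnergyGap`).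
* `FineGrains_of_bulkDefectVanish_of_optimal : BulkDefectVanish → OptimalPeriodicIsAdmissibleHcp →
  FineGrains` (LineTwo, card self-certifying-grains): the shared hinge stmt-0751 BY NAME, the landed stubs
  `stub_selfCertify` (fine grains certify their periodic pattern as a MINIMISER of the energy per particle)
  and `stub_lineTwoGlue`, and the ONE open hypothesis "every periodic Lennard-Jones minimiser is an
  admissible affine hcp two-lattice" (⊇ HcpPeriodicMinimiser stmt-3061 + uniqueness up to isometry; spelled
  out in the binder).

`Lam`/`Near`/`Adm`/`Inner` are the crux's `let`s verbatim (`Theorems.CoarseGrains.Negative.PredicateAPI`);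
`fineGrains_iff` (`Iff.rfl`) and `HasFineBall` come from `Theorems.FineGrains.Negative.LoadBearing`.
-/

noncomputable section

open Literature.MathematicalPhysics.StatisticalMechanics
open Summit.AtomisticToContinuum.Crystallization.Theorems.CoarseGrains.Negative.PredicateAPI
open Summit.AtomisticToContinuum.Crystallization.Theorems.FineGrains.Negative.LoadBearing
open Summit.AtomisticToContinuum.Crystallization.Theorems.ExcessDecayLiouvilleCoarseGrains
open Summit.AtomisticToContinuum.Crystallization.Theorems.ExcessDecayLiouvilleGrainsGlue (near_of_ball_subset)
open Summit.AtomisticToContinuum.Crystallization.Theses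

namespace Summit.AtomisticToContinuum.Crystallization.Theorems.ExcessDecayLiouvilleFineGrains

/-- **Sibling reduction — `FineGrains` BY NAME from `HcpBulkFloor` (stmt-14477) and `HcpDefectCoercivity`
(stmt-14476), BY NAME** (CONDITIONAL on those two items).  Verbatim re-run of the landed `CoarseGrains_of`
at `(ρ, ε)`: floor point `(a,h)` pinned into the admissible window (`windowPin` +
`energyPerParticle_le_of_floor`), `δ` from `LennardJonesMinimalDistance_holds`, `(θ, R')` from
`trussPropagation` at `(δ, ρ, ε)`, `κ(δ,θ)` from coercivity, `N₀` from `stub_trialBound` at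
`η = κ/(2(2R'/δ+1)³)`; `κ·#Bad(4,θ) ≤ E(N) − N·e ≤ N·η` gives the clean ball (`exists_clean_ball`), a
radius-`ρ` chart at tolerance `ε` (`trussPropagation`), and the crux datum centred at the clean particle
(`stub_isoDictionaryAt`). -/
theorem FineGrains_of_defectCounting (hFloor : HcpDefectCounting.HcpBulkFloor)
    (hCoer : HcpDefectCounting.HcpDefectCoercivity) : ExcessDecayLiouville.FineGrains := by
  classical
  rw [fineGrains_iff]
  intro ρ ε hρ hε
  obtain ⟨a, h, ha, hh, ha₁, ha₂, hh₁, hh₂, hfloor⟩ := hFloor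
  obtain ⟨hwa, hwh⟩ := windowPin a h ha hh ha₁ ha₂ hh₁ hh₂ fun a' h' ha' hh' =>
    energyPerParticle_le_of_floor ha hh hfloor (hcpPeriodicConfiguration ha' hh')
  obtain ⟨δ, hδ, hsep⟩ := LennardJonesMinimalDistance_holds
  obtain ⟨θ, hθ, R', hR', hchart⟩ :=
    trussPropagation a h ha hh ha₁ ha₂ hh₁ hh₂ δ ρ ε hδ hρ hε
  obtain ⟨κ, hκ, hcoer⟩ := hCoer a h ha hh ha₁ ha₂ hh₁ hh₂ hfloor δ θ hδ hθ
  set C : ℝ := (2 * R' / δ + 1) ^ 3 with hC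
  have hCpos : 0 < C := by positivity
  obtain ⟨N₁, hN₁⟩ :=
    stub_trialBound (hcpPeriodicConfiguration ha hh) (κ / (2 * C)) (by positivity)
  refine ⟨max N₁ 1, fun N hN x hx => ?_⟩
  have hN₁' : N₁ ≤ N := le_of_max_le_left hN
  have hNpos : (0 : ℝ) < N := by exact_mod_cast le_of_max_le_right hN
  have hxsep : ∀ i j : Fin N, i ≠ j → δ ≤ dist (x i) (x j) := hsep N x hx
  -- energy bookkeeping: κ·#Bad ≤ 𝓔(x) − N·e = E(N) − N·e ≤ N·κ/(2C)
  have hcoerx := hcoer N x hxsep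
  dsimp only at hcoerx
  have hE : interactionEnergy lennardJones x = groundStateEnergy lennardJones 3 N := hx.2
  have htrial := hN₁ N hN₁'
  rw [hE] at hcoerx
  set e : ℝ := (hcpPeriodicConfiguration ha hh).energyPerParticle lennardJones with he
  set bad : ℝ := (Nat.card {i : Fin N // ¬ ∃ A : EuclideanSpace ℝ (Fin 3) →ₗᵢ[ℝ]
      EuclideanSpace ℝ (Fin 3),
      (∀ p ∈ (hcpPeriodicConfiguration ha hh).points, ‖p‖ ≤ 4 →
        ∃ j : Fin N, dist (x j) (x i + A p) ≤ θ) ∧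
      (∀ j : Fin N, dist (x j) (x i) ≤ 4 →
        ∃ p ∈ (hcpPeriodicConfiguration ha hh).points, dist (x j) (x i + A p) ≤ θ)} : ℝ)
    with hbad
  have hbad0 : 0 ≤ bad := by positivity
  have hk : κ * bad ≤ (N : ℝ) * (κ / (2 * C)) := by linarith
  have hk2 : κ * (bad * (2 * C)) ≤ κ * N := by
    have h2C : (0 : ℝ) < 2 * C := by positivity
    have h1 : κ * bad ≤ (N : ℝ) * κ / (2 * C) := by simpa [mul_div_assoc] using hk
    have h3 := (le_div_iff₀ h2C).1 h1
    nlinarith [h3]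
  have hk3 : bad * (2 * C) ≤ N := le_of_mul_le_mul_left hk2 hκ
  have hcount : C * bad < N := by nlinarith [hk3, hCpos, hNpos, hbad0]
  -- clean ball by counting Bad(4,θ) particles over balls centred at particles
  obtain ⟨i, hi⟩ := exists_clean_ball x hδ hR' hxsep _ hcount
  -- truss propagation: the clean ball carries a radius-ρ chart at tolerance ε
  have hcharti := hchart N x hxsep
  dsimp only at hcharti
  have hgood := hcharti i fun j hj => not_not.1 (hi j hj)
  -- dictionary: the chart is a FineGrains datum centred at `x i`
  obtain ⟨t, A', hA', -, hNear⟩ := stub_isoDictionaryAt a h ha hh hwa hwh ε N x i ρ hgood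
  exact ⟨x i, t, A', hA', hNear⟩

/-- **`TubeRigidity` from the tube energy gap** (the cycle-2 reshape of line `Sketch`, sorry-free given
the gap): the gap's competitor and the `ηR³`-almost-minimality give `κ·Q(c, R-2) ≤ ηR³ + CR²`; the landed
`stub_pigeonholeBall` gives a ball `B_{ρ+5}(c')` with `Q(c', ρ+5) ≤ (ηR³ + CR²)/(κ M₀ R³) ≤ θ` once
`η = κθM₀/2` and `R ≥ 2|C|/(κθM₀)`; the landed `stub_localFlatness` gives the `ε`-fine `ρ`-ball. -/
theorem tubeRigidity_of_tubeEnergyGap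
    (hG : ∀ δ : ℝ, 0 < δ → ∃ κ : ℝ, 0 < κ ∧ ∃ C R₂ : ℝ, ∀ R : ℝ, R₂ ≤ R →
      ∀ (c : E3) (t : Fin 2 → E3) (A : E3 →L[ℝ] E3), Adm A → Inner t A →
      ∀ (n : ℕ) (y : Fin n → E3), Function.Injective y →
        (∀ i j : Fin n, i ≠ j → δ ≤ dist (y i) (y j)) →
        (∀ i : Fin n, dist (y i) c ≤ R) →
        (∀ i : Fin n, ∃ m : Fin 2, ∃ z ∈ Lam, dist (y i) (t m + A z) ≤ 1 / 40) →
        Near (Set.range y) c (R - 1) t A (1 / 40) →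
        ∃ (d : Fin 2 → E3) (m : Fin n → Fin 2) (z : Fin n → E3),
          (∀ k : Fin 2, ‖d k‖ ≤ 1) ∧
          (∀ i : Fin n, z i ∈ Lam ∧ dist (y i) (t (m i) + A (z i)) ≤ 1 / 40) ∧
          ∃ (n' : ℕ) (y' : Fin n' → E3), n' ≤ n ∧ Function.Injective y' ∧
            (∀ i : Fin n', dist (y' i) c ≤ R - 1) ∧
            interactionEnergy lennardJones y' +
              κ * (∑ i : Fin n, ∑ j : Fin n,
                if dist (y i) c ≤ R - 2 ∧ dist (y j) c ≤ R - 2 ∧ dist (y i) (y j) ≤ 4 then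
                  ‖(y i - (t (m i) + d (m i) + A (z i))) - (y j - (t (m j) + d (m j) + A (z j)))‖ ^ 2
                else 0) ≤
            interactionEnergy lennardJones y + C * R ^ 2) :
    ∀ ρ ε δ : ℝ, 0 < ρ → 0 < ε → 0 < δ → ∃ η : ℝ, 0 < η ∧ ∃ R₁ : ℝ, ∀ R : ℝ, R₁ ≤ R →
    ∀ (c : E3) (t : Fin 2 → E3) (A : E3 →L[ℝ] E3), Adm A → Inner t A →
    ∀ (n : ℕ) (y : Fin n → E3), Function.Injective y →
      (∀ i j : Fin n, i ≠ j → δ ≤ dist (y i) (y j)) →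
      (∀ i : Fin n, dist (y i) c ≤ R) →
      (∀ i : Fin n, ∃ m : Fin 2, ∃ z ∈ Lam, dist (y i) (t m + A z) ≤ 1 / 40) →
      Near (Set.range y) c (R - 1) t A (1 / 40) →
      (∀ (n' : ℕ) (y' : Fin n' → E3), n' ≤ n → Function.Injective y' →
        (∀ i : Fin n', dist (y' i) c ≤ R - 1) →
        interactionEnergy lennardJones y ≤ interactionEnergy lennardJones y' + η * R ^ 3) →
      ∃ (c' : E3) (t' : Fin 2 → E3) (A' : E3 →L[ℝ] E3),
        Adm A' ∧ dist c' c + ρ ≤ R - 1 ∧ Near (Set.range y) c' ρ t' A' ε := by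
  intro ρ ε δ hρ hε hδ
  obtain ⟨κ, hκ, C, R₂, hG⟩ := hG δ hδ
  obtain ⟨M₀, hM₀, R₀, hP⟩ := stub_pigeonholeBall ρ hρ
  obtain ⟨θ, hθ, hL⟩ := stub_localFlatness ρ ε hρ hε
  refine ⟨κ * θ * M₀ / 2, by positivity, max (max R₂ R₀) (max 1 (2 * |C| / (κ * θ * M₀))), ?_⟩
  intro R hR c t A hA hI n y hy hsep hball htube hNear hmin
  have hR₂ : R₂ ≤ R := le_trans (le_max_left _ _) (le_trans (le_max_left _ _) hR)
  have hR₀ : R₀ ≤ R := le_trans (le_max_right _ _) (le_trans (le_max_left _ _) hR)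
  have hR1 : 1 ≤ R := le_trans (le_max_left _ _) (le_trans (le_max_right _ _) hR)
  have hRC : 2 * |C| / (κ * θ * M₀) ≤ R := le_trans (le_max_right _ _) (le_trans (le_max_right _ _) hR)
  have hRpos : 0 < R := lt_of_lt_of_le one_pos hR1
  -- (G): the competitor and the quadratic form
  obtain ⟨d, m, z, hd, hsite, n', y', hn', hy', hball', hgap⟩ :=
    hG R hR₂ c t A hA hI n y hy hsep hball htube hNear
  -- almost-minimality against that competitor
  have hcomp := hmin n' y' hn' hy' hball'
  set Q : ℝ := ∑ i : Fin n, ∑ j : Fin n,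
      if dist (y i) c ≤ R - 2 ∧ dist (y j) c ≤ R - 2 ∧ dist (y i) (y j) ≤ 4 then
        ‖(y i - (t (m i) + d (m i) + A (z i))) - (y j - (t (m j) + d (m j) + A (z j)))‖ ^ 2
      else 0 with hQ
  have hκQ : κ * Q ≤ κ * θ * M₀ / 2 * R ^ 3 + C * R ^ 2 := by linarith
  -- (P1): pigeonhole with the weight `w i j = [dist ≤ 4] ‖v i - v j‖²`
  set w : Fin n → Fin n → ℝ := fun i j =>
      if dist (y i) (y j) ≤ 4 then
        ‖(y i - (t (m i) + d (m i) + A (z i))) - (y j - (t (m j) + d (m j) + A (z j)))‖ ^ 2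
      else 0 with hw
  have hw0 : ∀ i j, 0 ≤ w i j := fun i j => by
    simp only [hw]; split_ifs <;> positivity
  obtain ⟨c', hc', hpig⟩ := hP R hR₀ c n y w hw0
  have hQw : (∑ i : Fin n, ∑ j : Fin n,
      if dist (y i) c ≤ R - 2 ∧ dist (y j) c ≤ R - 2 then w i j else 0) = Q := by
    simp only [hQ, hw]
    refine Finset.sum_congr rfl fun i _ => Finset.sum_congr rfl fun j _ => ?_
    by_cases h1 : dist (y i) c ≤ R - 2 ∧ dist (y j) c ≤ R - 2
    · by_cases h2 : dist (y i) (y j) ≤ 4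
      · rw [if_pos h1, if_pos h2, if_pos ⟨h1.1, h1.2, h2⟩]
      · rw [if_pos h1, if_neg h2, if_neg (fun h => h2 h.2.2)]
    · rw [if_neg h1, if_neg (fun h => h1 ⟨h.1, h.2.1⟩)]
  rw [hQw] at hpig
  set Qloc : ℝ := ∑ i : Fin n, ∑ j : Fin n,
      if dist (y i) c' ≤ ρ + 5 ∧ dist (y j) c' ≤ ρ + 5 then w i j else 0 with hQloc
  have hQloc_eq : (∑ i : Fin n, ∑ j : Fin n,
      if dist (y i) c' ≤ ρ + 5 ∧ dist (y j) c' ≤ ρ + 5 ∧ dist (y i) (y j) ≤ 4 then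
        ‖(y i - (t (m i) + d (m i) + A (z i))) - (y j - (t (m j) + d (m j) + A (z j)))‖ ^ 2
      else 0) = Qloc := by
    simp only [hQloc, hw]
    refine Finset.sum_congr rfl fun i _ => Finset.sum_congr rfl fun j _ => ?_
    by_cases h1 : dist (y i) c' ≤ ρ + 5 ∧ dist (y j) c' ≤ ρ + 5
    · by_cases h2 : dist (y i) (y j) ≤ 4
      · rw [if_pos h1, if_pos h2, if_pos ⟨h1.1, h1.2, h2⟩]
      · rw [if_pos h1, if_neg h2, if_neg (fun h => h2 h.2.2)]
    · rw [if_neg h1, if_neg (fun h => h1 ⟨h.1, h.2.1⟩)]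
  -- the local form is at most θ
  have hkθM : 0 < κ * θ * M₀ := by positivity
  have hθ' : Qloc ≤ θ := by
    have h1 : M₀ * R ^ 3 * Qloc ≤ Q := hpig
    have h2 : κ * (M₀ * R ^ 3 * Qloc) ≤ κ * θ * M₀ / 2 * R ^ 3 + C * R ^ 2 :=
      le_trans (mul_le_mul_of_nonneg_left h1 hκ.le) hκQ
    have hC_le : C * R ^ 2 ≤ |C| * R ^ 2 :=
      mul_le_mul_of_nonneg_right (le_abs_self C) (by positivity)
    have hCR : |C| * R ^ 2 ≤ κ * θ * M₀ / 2 * R ^ 3 := by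
      have h1 : 2 * |C| ≤ κ * θ * M₀ * R := by
        have := (div_le_iff₀ hkθM).1 hRC
        linarith
      nlinarith [sq_nonneg R, hRpos]
    have h3 : κ * (M₀ * R ^ 3 * Qloc) ≤ κ * θ * M₀ * R ^ 3 := by linarith
    have h4 : κ * M₀ * R ^ 3 * Qloc ≤ κ * M₀ * R ^ 3 * θ := by nlinarith
    have h5 : 0 < κ * M₀ * R ^ 3 := by positivity
    exact le_of_mul_le_mul_left h4 h5
  -- (P2): local flatness on B_ρ(c')
  have hNear' : Near (Set.range y) c' (ρ + 8) t A (1 / 40) :=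
    near_of_ball_subset hNear (by linarith)
  rw [← hQloc_eq] at hθ'
  obtain ⟨t', A', hA', hN'⟩ := hL c' t A hA hI n y d m z hd hsite hNear' hθ'
  exact ⟨c', t', A', hA', by linarith, hN'⟩

/-- **LineOne — `FineGrains` BY NAME from `CoarseGrains` (crux stmt-9331, BY NAME) and the one open
hypothesis `TubeEnergyGap` (registered stub `stub_tubeEnergyGap` of line `Sketch`, spelled out), via the
LANDED stubs `stub_flatComparison` (hereditary slack), `stub_lineOneGlue`, `stub_pigeonholeBall`,
`stub_localFlatness`** (CONDITIONAL on `CoarseGrains` and on the tube energy gap). -/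
theorem FineGrains_of_coarseGrains_of_tubeEnergyGap (hCG : ExcessDecayLiouville.CoarseGrains)
    (hG : ∀ δ : ℝ, 0 < δ → ∃ κ : ℝ, 0 < κ ∧ ∃ C R₂ : ℝ, ∀ R : ℝ, R₂ ≤ R →
      ∀ (c : E3) (t : Fin 2 → E3) (A : E3 →L[ℝ] E3), Adm A → Inner t A →
      ∀ (n : ℕ) (y : Fin n → E3), Function.Injective y →
        (∀ i j : Fin n, i ≠ j → δ ≤ dist (y i) (y j)) →
        (∀ i : Fin n, dist (y i) c ≤ R) →
        (∀ i : Fin n, ∃ m : Fin 2, ∃ z ∈ Lam, dist (y i) (t m + A z) ≤ 1 / 40) →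
        Near (Set.range y) c (R - 1) t A (1 / 40) →
        ∃ (d : Fin 2 → E3) (m : Fin n → Fin 2) (z : Fin n → E3),
          (∀ k : Fin 2, ‖d k‖ ≤ 1) ∧
          (∀ i : Fin n, z i ∈ Lam ∧ dist (y i) (t (m i) + A (z i)) ≤ 1 / 40) ∧
          ∃ (n' : ℕ) (y' : Fin n' → E3), n' ≤ n ∧ Function.Injective y' ∧
            (∀ i : Fin n', dist (y' i) c ≤ R - 1) ∧
            interactionEnergy lennardJones y' +
              κ * (∑ i : Fin n, ∑ j : Fin n,
                if dist (y i) c ≤ R - 2 ∧ dist (y j) c ≤ R - 2 ∧ dist (y i) (y j) ≤ 4 then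
                  ‖(y i - (t (m i) + d (m i) + A (z i))) - (y j - (t (m j) + d (m j) + A (z j)))‖ ^ 2
                else 0) ≤
            interactionEnergy lennardJones y + C * R ^ 2) :
    ExcessDecayLiouville.FineGrains :=
  fineGrains_iff.2 (stub_lineOneGlue hCG stub_flatComparison (tubeRigidity_of_tubeEnergyGap hG))

/-- **LineTwo — `FineGrains` BY NAME from `BulkDefectVanish` (shared hinge stmt-0751, BY NAME) and the one
open hypothesis "every periodic minimiser of the Lennard-Jones energy per particle in `ℝ³` is, as a point
set, an admissible affine hcp two-lattice" (registered stub `stub_optimalPeriodicIsAdmissibleHcp` of line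
`Sketch`, spelled out; ⊇ HcpPeriodicMinimiser stmt-3061 + uniqueness up to isometry), via the LANDED
stubs `stub_selfCertify` (fine grains certify their pattern as a minimiser) and `stub_lineTwoGlue`**
(CONDITIONAL on stmt-0751 and on the uniqueness hypothesis). -/
theorem FineGrains_of_bulkDefectVanish_of_optimal (h0751 : HcpDefectCounting.BulkDefectVanish)
    (hOpt : ∀ Q : PeriodicConfiguration 3,
      IsLeast (Set.range fun Q' : PeriodicConfiguration 3 => Q'.energyPerParticle lennardJones)
        (Q.energyPerParticle lennardJones) →
      ∃ (t : Fin 2 → E3) (A : E3 →L[ℝ] E3), Adm A ∧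
        Q.points = {p | ∃ m : Fin 2, ∃ z ∈ Lam, p = t m + A z}) :
    ExcessDecayLiouville.FineGrains :=
  fineGrains_iff.2 (stub_lineTwoGlue h0751 stub_selfCertify hOpt)

end Summit.AtomisticToContinuum.Crystallization.Theorems.ExcessDecayLiouvilleFineGrains

end
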